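import Summits.ValiantsHypothesis.ValiantsHypothesis.Theorems.DefinabilityGapRoundOneAll
import Summits.ValiantsHypothesis.ValiantsHypothesis.Theorems.DefinabilityGapTwoRepicks
import HarnessLib

/-!
# Definability gap, ROAD P: THE ALTERATION, ASSEMBLED (PLAN (d) v3 — numerics and schedule)

`exists_roundOneAll` and `two_repicks` instantiated: `K₁ = 401 m` movers, re-pick laws
`p₂ = 4e^{44}/m`, `p₃ = 8e^{44}/m`, `K₂ = ⌈4κ₂⌉ + 1` (`κ₂ = (4e^{44})²·2·401²`), blocked budget
`λ = m e^{−44}/16`, load increments `m/16`, free-position decrements `B₁/8`; both failure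
budgets are `< 1` for all large `m` (Bernstein factors `≤ e^{−3t/8}` once `t ≥ 3·mean`).
**`kiPivotAltered_A`**: for all large `m`, every `T` with `#T ≤ 2q+1` has a pivot column `s₀` and
rows `r` obeying the row rule, off the Phase-A bad set of schedule `(MC, NC, m/2, pC, tA, BA)`
(`tA = tC + m/8 + I₂ + I₃`, `BA = B₁/2`), with `s₀` free for EVERY curve; **`scheduleA_ok`**: the
schedule arithmetic.  These are literally (ALT) and (NUM) of the lens glue
`k1Clause_one_of_altered`: R_K1.1 (`K1Clause 1`) follows (lens v7 §7e).
-/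

namespace Summit.ValiantsHypothesis.ValiantsHypothesis.Theorems.DefinabilityGapAlteration

open Filter Topology Real Finset Literature.Probability.Moments
open Literature.Computability.AlgebraicComplexity Literature.Computability.MetaComplexity
open Summit.ValiantsHypothesis.ValiantsHypothesis.Theorems.DefinabilityGapAffineRung
open Summit.ValiantsHypothesis.ValiantsHypothesis.Theorems.DefinabilityGapPivotCertificate
open Summit.ValiantsHypothesis.ValiantsHypothesis.Theorems.DefinabilityGapPivotAdmissible
open Summit.ValiantsHypothesis.ValiantsHypothesis.Theorems.DefinabilityGapPivotPhaseA
open Summit.ValiantsHypothesis.ValiantsHypothesis.Theorems.DefinabilityGapCrowdedFree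
open Summit.ValiantsHypothesis.ValiantsHypothesis.Theorems.DefinabilityGapPivotColumn
open Summit.ValiantsHypothesis.ValiantsHypothesis.Theorems.DefinabilityGapAsymptotics
open Summit.ValiantsHypothesis.ValiantsHypothesis.Theorems.DefinabilityGapNumerics
open Summit.ValiantsHypothesis.ValiantsHypothesis.Theorems.DefinabilityGapPhaseABad
open Summit.ValiantsHypothesis.ValiantsHypothesis.Theorems.DefinabilityGapMovers
open Summit.ValiantsHypothesis.ValiantsHypothesis.Theorems.DefinabilityGapAlterationStep
open Summit.ValiantsHypothesis.ValiantsHypothesis.Theorems.DefinabilityGapRoundOne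
open Summit.ValiantsHypothesis.ValiantsHypothesis.Theorems.DefinabilityGapRoundOneAll
open Summit.ValiantsHypothesis.ValiantsHypothesis.Theorems.DefinabilityGapRepick
open Summit.ValiantsHypothesis.ValiantsHypothesis.Theorems.DefinabilityGapTwoRepicks

/-! ## 1. Parameters -/
/-- Round-one mover bound `K₁ = 401 m`. [this file] -/
def K₁ (m : ℕ) : ℕ := 401 * m

/-- First re-pick law bound `p₂ = 4 e^{44}/m = 1/n₁`. [this file] -/
noncomputable def p₂ (m : ℕ) : ℝ := 4 * exp 44 / m

/-- Mean landing load of round two: `p₂ (2K₁+1) ≤ I₂ = 4 e^{44} · 803`. [this file] -/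
noncomputable def I₂ : ℝ := 4 * exp 44 * 803

/-- `κ₂ = p₂² · 2K₁² = (4e^{44})² · 2 · 401²`. [this file] -/
noncomputable def κ₂ : ℝ := (4 * exp 44) ^ 2 * (2 * 401 ^ 2)

/-- Second-round mover bound `K₂ = ⌈4κ₂⌉ + 1`. [this file] -/
noncomputable def K₂ : ℕ := ⌈4 * κ₂⌉₊ + 1

/-- Second re-pick law bound `p₃ = 8 e^{44}/m`. [this file] -/
noncomputable def p₃ (m : ℕ) : ℝ := 8 * exp 44 / m

/-- Mean landing load of round three: `p₃ (2K₂+1) ≤ I₃ = 8 e^{44} (2K₂+1)`. [this file] -/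
noncomputable def I₃ : ℝ := 8 * exp 44 * (2 * K₂ + 1)

/-- Blocked-row budget per round `λ = m e^{−44}/16`. [this file] -/
noncomputable def lam (m : ℕ) : ℝ := (m : ℝ) * exp (-44) / 16

/-- Round-one room `n₁ = m e^{−44}/4`. [this file] -/
noncomputable def n₁ (m : ℕ) : ℝ := (m : ℝ) * exp (-44) / 4

/-- Final load threshold `tA = tC + m/8 + I₂ + I₃`. [this file] -/
noncomputable def tA (m : ℕ) : ℝ := tC m + (m : ℝ) / 8 + I₂ + I₃

/-- Final free-position demand `BA = B₁/2`. [this file] -/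
noncomputable def BA (m : ℕ) : ℕ := B₁ m / 2

/-- `0 < I₂`. [this file] -/
theorem I₂_pos : 0 < I₂ := by unfold I₂; positivity
/-- `0 < I₃`. [this file] -/
theorem I₃_pos : 0 < I₃ := by unfold I₃; positivity

/-- `4 κ₂ < K₂`. [this file] -/
theorem four_κ₂_lt : 4 * κ₂ < (K₂ : ℝ) := by
  unfold K₂; push_cast; linarith [Nat.le_ceil (4 * κ₂)]

/-- `λ ≤ m/16`. [this file] -/
theorem lam_le (m : ℕ) : lam m ≤ (m : ℝ) / 16 := by
  unfold lam
  have h1 : exp (-44 : ℝ) ≤ 1 := exp_le_one_iff.mpr (by norm_num)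
  have hm : (0 : ℝ) ≤ m := Nat.cast_nonneg _
  nlinarith

/-! ## 2. Bernstein factors once the deviation dominates the mean -/

/-- `eRow p I t ≤ e^{−3t/8}` for `t ≥ 3 p I`. [this file] -/
theorem eRow_le_exp {p I t : ℝ} (hI : 0 ≤ p * I) (ht : 3 * (p * I) ≤ t) (ht0 : 0 < t) :
    eRow p I t ≤ exp (-(3 * t / 8)) := by
  unfold eRow
  refine exp_le_exp.2 (neg_le_neg_iff.2 ?_)
  rw [le_div_iff₀ (by positivity : (0 : ℝ) < 2 * (2 * (p * I) + 2 * t / 3))]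
  nlinarith [mul_le_mul_of_nonneg_left ht ht0.le]

/-- `eCol p I t ≤ e^{−3t/8}` for `t ≥ 3 p I`. [this file] -/
theorem eCol_le_exp {p I t : ℝ} (hI : 0 ≤ p * I) (ht : 3 * (p * I) ≤ t) (ht0 : 0 < t) :
    eCol p I t ≤ exp (-(3 * t / 8)) := by
  unfold eCol
  refine exp_le_exp.2 (neg_le_neg_iff.2 ?_)
  rw [le_div_iff₀ (by positivity : (0 : ℝ) < 2 * (p * I + 1 * t / 3))]
  nlinarith [mul_le_mul_of_nonneg_left ht ht0.le]

/-- The four Bernstein factors of a round with deviations `t₂, δ ≥ 3 p I`. [this file] -/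
theorem four_factors_le {p I t₂ δ : ℝ} (hI : 0 ≤ p * I) (ht : 3 * (p * I) ≤ t₂) (ht0 : 0 < t₂)
    (hδ : 3 * (p * I) ≤ δ) (hδ0 : 0 < δ) :
    eRow p I t₂ + eCol p I t₂ + eRow p I δ + eCol p I δ ≤
      2 * exp (-(3 * t₂ / 8)) + 2 * exp (-(3 * δ / 8)) := by
  have h1 := eRow_le_exp hI ht ht0
  have h2 := eCol_le_exp hI ht ht0
  have h3 := eRow_le_exp hI hδ hδ0
  have h4 := eCol_le_exp hI hδ hδ0
  linarith

/-! ## 3. The numerics, eventually -/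

/-- `C m^k e^{−3λ/8} < 1/8` eventually. [this file] -/
theorem lam_tail_eventually (k : ℕ) (C : ℝ) :
    ∀ᶠ m : ℕ in atTop, C * (m : ℝ) ^ k * exp (-(3 * lam m / 8)) < 1 / 8 := by
  have ha : (0 : ℝ) < 3 * exp (-44) / 128 := by positivity
  filter_upwards [eventually_const_mul_pow_mul_exp_neg_lt k ha C
    (show (0 : ℝ) < 1 / 8 by norm_num)] with m hm
  have : 3 * lam m / 8 = 3 * exp (-44) / 128 * m := by unfold lam; ring
  rwa [this]

/-- The load-increment factors: `(4m²+5) m · 2e^{−3(m/16)/8} < 1/8` eventually. [this file] -/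
theorem t_tail_eventually : ∀ᶠ m : ℕ in atTop,
    (4 * (m : ℝ) ^ 2 + 5) * m * (2 * exp (-(3 * ((m : ℝ) / 16) / 8))) < 1 / 8 := by
  have ha : (0 : ℝ) < 3 / 128 := by norm_num
  filter_upwards [eventually_ge_atTop 3,
    eventually_const_mul_pow_mul_exp_neg_lt 3 ha 10 (show (0 : ℝ) < 1 / 8 by norm_num)]
    with m hm h
  have hm3 : (3 : ℝ) ≤ m := by exact_mod_cast hm
  have h10 : (4 * (m : ℝ) ^ 2 + 5) * m * 2 ≤ 10 * (m : ℝ) ^ 3 := by nlinarith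
  have heq : 3 * ((m : ℝ) / 16) / 8 = 3 / 128 * m := by ring
  rw [heq]
  calc (4 * (m : ℝ) ^ 2 + 5) * m * (2 * exp (-(3 / 128 * m)))
      = (4 * (m : ℝ) ^ 2 + 5) * m * 2 * exp (-(3 / 128 * m)) := by ring
    _ ≤ 10 * (m : ℝ) ^ 3 * exp (-(3 / 128 * m)) :=
        mul_le_mul_of_nonneg_right h10 (exp_pos _).le
    _ < 1 / 8 := h

/-- A linear lower bound for `B₁`. [this file] -/
theorem B₁_ge_linear (m : ℕ) :
    θ₀ * 47 / 256 * (θ₀ / 131072) * (m : ℝ) - (θ₀ * 47 / 256 * (θ₀ / 65536 + 1) + 1) ≤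
      (B₁ m : ℝ) := by
  have h1 := B₁_real_ge m
  have h2 := sC_ge_linear m
  have hθ := theta0_pos
  nlinarith

/-- The free-position-decrement factors: `(4m²+5) m · 2e^{−3(B₁/8)/8} < 1/8` eventually.
[this file] -/
theorem δ_tail_eventually : ∀ᶠ m : ℕ in atTop,
    (4 * (m : ℝ) ^ 2 + 5) * m * (2 * exp (-(3 * ((B₁ m : ℝ) / 8) / 8))) < 1 / 8 := by
  have hθ := theta0_pos
  set a : ℝ := θ₀ * 47 / 256 * (θ₀ / 131072) with ha_def
  set b : ℝ := θ₀ * 47 / 256 * (θ₀ / 65536 + 1) + 1 with hb_def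
  have ha : (0 : ℝ) < 3 * a / 64 := by positivity
  filter_upwards [eventually_ge_atTop 3,
    eventually_const_mul_pow_mul_exp_sub_lt 3 ha 10 (3 * b / 64) (show (0 : ℝ) < 1 / 8 by norm_num)]
    with m hm h
  have hm3 : (3 : ℝ) ≤ m := by exact_mod_cast hm
  have h10 : (4 * (m : ℝ) ^ 2 + 5) * m * 2 ≤ 10 * (m : ℝ) ^ 3 := by nlinarith
  have hB := B₁_ge_linear m
  have hexp : exp (-(3 * ((B₁ m : ℝ) / 8) / 8)) ≤ exp (3 * b / 64 - 3 * a / 64 * m) :=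
    exp_le_exp.2 (by rw [ha_def, hb_def]; linarith)
  calc (4 * (m : ℝ) ^ 2 + 5) * m * (2 * exp (-(3 * ((B₁ m : ℝ) / 8) / 8)))
      = (4 * (m : ℝ) ^ 2 + 5) * m * 2 * exp (-(3 * ((B₁ m : ℝ) / 8) / 8)) := by ring
    _ ≤ 10 * (m : ℝ) ^ 3 * exp (3 * b / 64 - 3 * a / 64 * m) :=
        mul_le_mul h10 hexp (exp_pos _).le (by positivity)
    _ < 1 / 8 := h

/-- The third-round collision term `p₃² · 2K₂² < 1/4` eventually. [this file] -/
theorem p₃_eventually : ∀ᶠ m : ℕ in atTop, p₃ m ^ 2 * (2 * (K₂ : ℝ) * K₂) / 1 < 1 / 4 := by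
  set C : ℝ := (8 * exp 44) ^ 2 * (2 * (K₂ : ℝ) * K₂) with hC
  have hC0 : 0 ≤ C := by positivity
  filter_upwards [eventually_ge_atTop 1,
    (tendsto_const_div_atTop_nhds_zero_nat C).eventually (gt_mem_nhds (show (0 : ℝ) < 1 / 4 by
      norm_num))] with m hm h
  have hm1 : (1 : ℝ) ≤ m := by exact_mod_cast hm
  have hm0 : (0 : ℝ) < m := by linarith
  have hle : p₃ m ^ 2 * (2 * (K₂ : ℝ) * K₂) / 1 ≤ C / m := by
    rw [div_one]
    have : p₃ m ^ 2 * (2 * (K₂ : ℝ) * K₂) = C / ((m : ℝ) ^ 2) := by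
      rw [hC]; unfold p₃; field_simp
    rw [this]
    exact div_le_div_of_nonneg_left hC0 hm0 (by nlinarith)
  exact lt_of_le_of_lt hle h

/-- The linear dominations, eventually. [this file] -/
theorem linear_eventually : ∀ᶠ m : ℕ in atTop,
    3 * I₂ ≤ lam m ∧ 3 * I₃ ≤ lam m ∧ 16 * I₂ ≤ (m : ℝ) * exp (-44) ∧
      8 * (I₂ + I₃) ≤ (m : ℝ) ∧ 3 * (I₂ + I₃) ≤ (B₁ m : ℝ) / 8 ∧ 2 * BC ≤ B₁ m := by
  have hlam : Tendsto lam atTop atTop :=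
    (tendsto_natCast_atTop_atTop.atTop_mul_const (exp_pos (-44))).atTop_div_const
      (by norm_num)
  have hmx : Tendsto (fun m : ℕ => (m : ℝ) * exp (-44)) atTop atTop :=
    tendsto_natCast_atTop_atTop.atTop_mul_const (exp_pos _)
  have hB8 : Tendsto (fun m : ℕ => (B₁ m : ℝ) / 8) atTop atTop :=
    tendsto_B₁.atTop_div_const (by norm_num)
  filter_upwards [hlam.eventually_ge_atTop (3 * I₂), hlam.eventually_ge_atTop (3 * I₃),
    hmx.eventually_ge_atTop (16 * I₂),
    tendsto_natCast_atTop_atTop.eventually_ge_atTop (8 * (I₂ + I₃)),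
    hB8.eventually_ge_atTop (3 * (I₂ + I₃)),
    tendsto_B₁.eventually_ge_atTop (((2 * BC : ℕ) : ℝ))] with m h1 h2 h3 h4 h5 h6
  exact ⟨h1, h2, h3, h4, h5, by exact_mod_cast h6⟩

/-! ## 4. The alteration, assembled -/

set_option maxHeartbeats 1000000 in
open scoped Classical in
/-- **(ALT) FOR SCHEDULE A**: for all large `m`, every `T` with `#T ≤ 2q+1` has a pivot column
and rows obeying the row rule, off the Phase-A bad set `(MC, NC, m/2, pC, tA, BA)`, with the pivot
column free for every curve. [this file] -/
theorem kiPivotAltered_A : ∃ m₀ : ℕ, ∀ m : ℕ, m₀ ≤ m →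
    ∀ T : Finset (Fin 3 → Fin (qOf m)), T.card ≤ 2 * qOf m + 1 →
      ∃ (s₀ : Fin m) (r : (Fin 3 → Fin (qOf m)) → Fin m),
        r ∉ phaseABad T (MC m) (NC m) (m / 2) (pC m) (tA m) ((BA m : ℕ) : ℝ) ∧
        (∀ c, r c ∉ heavyRows T c (NC m)) ∧ ∀ c ∈ T, s₀ ∈ freeCols T c r (r c) := by
  obtain ⟨m₁, hm₁⟩ := exists_roundOneAll
  obtain ⟨m₂, hm₂⟩ := Filter.eventually_atTop.mp
    ((eventually_ge_atTop 64).and ((lam_tail_eventually 1 401).and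
      ((lam_tail_eventually 0 K₂).and (t_tail_eventually.and (δ_tail_eventually.and
        (p₃_eventually.and linear_eventually))))))
  refine ⟨max m₁ m₂, fun m hm T hT => ?_⟩
  obtain ⟨h64, hE1, hE1', hE2, hE3, hE4, hI₂lam, hI₃lam, hI₂16, hI8, hIB, hBC⟩ :=
    hm₂ m (le_of_max_le_right hm)
  have hm0 : 0 < m := by omega
  have hm0' : (0 : ℝ) < m := by exact_mod_cast hm0
  have hm1 : (1 : ℝ) ≤ m := by exact_mod_cast hm0
  obtain ⟨s₀, hs₀⟩ := exists_pivotColumn T hm0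
  obtain ⟨r₁, hrule, hr₁, hcoll, hroom⟩ := hm₁ m (le_of_max_le_left hm) T hT s₀ hs₀
  have hadm : ∀ c, r₁ c ∈ (heavyRows T c (NC m))ᶜ := fun c => Finset.mem_compl.mpr (hrule c)
  have hTc : (T.card : ℝ) ≤ 4 * (m : ℝ) ^ 2 + 5 := by
    have hT2 : 2 * T.card ≤ 2 * (2 * qOf m + 1) := by omega
    have h := card_bound m
    have : ((2 * T.card : ℕ) : ℝ) ≤ ((8 * (m * m) + 10 : ℕ) : ℝ) := by
      exact_mod_cast hT2.trans h
    push_cast at this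
    nlinarith
  have hTc5 : (T.card : ℝ) ≤ 5 * (m : ℝ) ^ 2 := by
    have : (64 : ℝ) ≤ m := by exact_mod_cast h64
    nlinarith
  set key : (Fin 3 → Fin (qOf m)) → ℕ := fun _ => 0 with hkey
  have hK₁ : (movers T s₀ r₁ key).card ≤ K₁ m := by
    have h1 := card_movers_le_collCount T s₀ r₁ key
    have hp := pC_le (m := m) (by omega)
    have hp0 := (pC_pos (m := m) (by omega)).le
    have hp2 : pC m ^ 2 ≤ 4 / (m : ℝ) ^ 2 := by
      calc pC m ^ 2 ≤ (2 / (m : ℝ)) ^ 2 := pow_le_pow_left₀ hp0 hp 2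
        _ = 4 / (m : ℝ) ^ 2 := by ring
    have hT1 : ((T.card - 1 : ℕ) : ℝ) ≤ T.card := by exact_mod_cast Nat.sub_le _ _
    have hT0 : (0 : ℝ) ≤ T.card := Nat.cast_nonneg _
    have hS : (T.card : ℝ) * (T.card - 1 : ℕ) ≤ 25 * (m : ℝ) ^ 4 := by
      calc (T.card : ℝ) * (T.card - 1 : ℕ) ≤ T.card * T.card :=
            mul_le_mul_of_nonneg_left hT1 hT0
        _ ≤ (5 * (m : ℝ) ^ 2) * (5 * (m : ℝ) ^ 2) := mul_le_mul hTc5 hTc5 hT0 (by positivity)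
        _ = 25 * (m : ℝ) ^ 4 := by ring
    have hQ : pC m ^ 2 * (2 * ((T.card : ℝ) * (T.card - 1 : ℕ)) / m) ≤ 200 * m := by
      calc pC m ^ 2 * (2 * ((T.card : ℝ) * (T.card - 1 : ℕ)) / m)
          ≤ 4 / (m : ℝ) ^ 2 * (2 * (25 * (m : ℝ) ^ 4) / m) :=
            mul_le_mul hp2 (div_le_div_of_nonneg_right (by linarith) hm0'.le) (by positivity)
              (by positivity)
        _ = 200 * m := by field_simp; ring
    have : ((movers T s₀ r₁ key).card : ℝ) < K₁ m := by
      calc ((movers T s₀ r₁ key).card : ℝ) ≤ (collCount T s₀ r₁ : ℕ) := by exact_mod_cast h1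
        _ < 2 * (pC m ^ 2 * (2 * ((T.card : ℝ) * (T.card - 1 : ℕ)) / m)) + 1 := hcoll
        _ ≤ K₁ m := by unfold K₁; push_cast; linarith
    exact_mod_cast this.le
  have hn₁ : 0 < n₁ m := by unfold n₁; positivity
  have hroom' : ∀ c ∈ movers T s₀ r₁ key,
      n₁ m ≤ ((((heavyRows T c (NC m))ᶜ) \ blockedRows T c r₁ s₀).card : ℝ) :=
    fun c hc => by unfold n₁; exact hroom c (mem_movers.mp hc).1
  have hK₂ : 0 < K₂ := Nat.succ_pos _
  have hp₂ : 0 < p₂ m := by unfold p₂; positivity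
  have hp₃ : 0 < p₃ m := by unfold p₃; positivity
  have he1 : (1 : ℝ) ≤ 4 * exp 44 := by
    have := one_le_exp (show (0 : ℝ) ≤ 44 by norm_num); linarith
  have hp₂m : 1 / (m : ℝ) ≤ p₂ m := by
    unfold p₂; exact div_le_div_of_nonneg_right he1 hm0'.le
  have hp₃m : 1 / (m : ℝ) ≤ p₃ m := by
    unfold p₃; exact div_le_div_of_nonneg_right (by linarith) hm0'.le
  have hp₂n : 1 / n₁ m ≤ p₂ m := by
    have : 1 / n₁ m = p₂ m := by unfold n₁ p₂; rw [exp_neg]; field_simp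
    exact this.le
  have hlam : 0 < lam m := by unfold lam; positivity
  have ht₂ : (0 : ℝ) < (m : ℝ) / 16 := by positivity
  have hB₁pos : (0 : ℝ) < B₁ m := by
    have : (2 * 2400 : ℕ) ≤ B₁ m := by unfold BC at hBC; exact hBC
    exact_mod_cast (show 0 < B₁ m by omega)
  have hδ : (0 : ℝ) < (B₁ m : ℝ) / 8 := by positivity
  have hI₂' : p₂ m * (2 * (K₁ m : ℝ) + 1) ≤ I₂ := by
    unfold p₂ K₁ I₂; push_cast
    rw [div_mul_eq_mul_div, div_le_iff₀ hm0']
    nlinarith [exp_pos (44 : ℝ)]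
  have hI₃' : p₃ m * (2 * (K₂ : ℝ) + 1) ≤ I₃ := by
    unfold p₃ I₃
    rw [div_mul_eq_mul_div]
    exact div_le_self (by positivity) hm1
  have hpI₂ : 0 ≤ p₂ m * (2 * (K₁ m : ℝ) + 1) := by positivity
  have hpI₃ : 0 ≤ p₃ m * (2 * (K₂ : ℝ) + 1) := by positivity
  have hlam16 := lam_le m
  have hn₂ge : (m : ℝ) * exp (-44) / 8 ≤ n₁ m - (p₂ m * (2 * (K₁ m : ℝ) + 1) + lam m) := by
    unfold n₁ lam; linarith
  have hn₂pos : (0 : ℝ) < (m : ℝ) * exp (-44) / 8 := by positivity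
  have hn₂ : 0 < n₁ m - (p₂ m * (2 * (K₁ m : ℝ) + 1) + lam m) := lt_of_lt_of_le hn₂pos hn₂ge
  have hp₃n : 1 / (n₁ m - (p₂ m * (2 * (K₁ m : ℝ) + 1) + lam m)) ≤ p₃ m := by
    have h8 : 1 / ((m : ℝ) * exp (-44) / 8) = p₃ m := by
      unfold p₃; rw [exp_neg]; field_simp
    exact (one_div_le_one_div_of_le hn₂pos hn₂ge).trans h8.le
  have hfac₂ := four_factors_le hpI₂ (by linarith) ht₂ (by linarith [I₃_pos.le]) hδ
  have hfac₃ := four_factors_le hpI₃ (by linarith) ht₂ (by linarith [I₂_pos.le]) hδ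
  have hTm0 : (0 : ℝ) ≤ (T.card : ℝ) * m := by positivity
  have htail : (T.card : ℝ) * m * (2 * exp (-(3 * ((m : ℝ) / 16) / 8)) +
      2 * exp (-(3 * ((B₁ m : ℝ) / 8) / 8))) < 1 / 4 := by
    have h1 : (T.card : ℝ) * m ≤ (4 * (m : ℝ) ^ 2 + 5) * m :=
      mul_le_mul_of_nonneg_right hTc hm0'.le
    have h2 : 0 ≤ 2 * exp (-(3 * ((m : ℝ) / 16) / 8)) + 2 * exp (-(3 * ((B₁ m : ℝ) / 8) / 8)) := by
      positivity
    have h3 := mul_le_mul_of_nonneg_right h1 h2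
    have h4 : (4 * (m : ℝ) ^ 2 + 5) * m * (2 * exp (-(3 * ((m : ℝ) / 16) / 8)) +
        2 * exp (-(3 * ((B₁ m : ℝ) / 8) / 8))) =
        (4 * (m : ℝ) ^ 2 + 5) * m * (2 * exp (-(3 * ((m : ℝ) / 16) / 8))) +
        (4 * (m : ℝ) ^ 2 + 5) * m * (2 * exp (-(3 * ((B₁ m : ℝ) / 8) / 8))) := by ring
    linarith
  have hsmall₂ : p₂ m ^ 2 * (2 * (K₁ m : ℝ) * K₁ m) / K₂ +
      K₁ m * eCol (p₂ m) (2 * K₁ m + 1) (lam m) +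
      (T.card : ℝ) * m * (eRow (p₂ m) (2 * K₁ m + 1) ((m : ℝ) / 16) +
        eCol (p₂ m) (2 * K₁ m + 1) ((m : ℝ) / 16) +
        eRow (p₂ m) (2 * K₁ m + 1) ((B₁ m : ℝ) / 8) +
        eCol (p₂ m) (2 * K₁ m + 1) ((B₁ m : ℝ) / 8)) < 1 := by
    have hκ : p₂ m ^ 2 * (2 * (K₁ m : ℝ) * K₁ m) = κ₂ := by
      unfold p₂ K₁ κ₂; push_cast; field_simp
    have hK₂' : (0 : ℝ) < K₂ := by exact_mod_cast hK₂
    have h1 : p₂ m ^ 2 * (2 * (K₁ m : ℝ) * K₁ m) / K₂ < 1 / 4 := by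
      rw [hκ, div_lt_iff₀ hK₂']; linarith [four_κ₂_lt]
    have h2 : (K₁ m : ℝ) * eCol (p₂ m) (2 * K₁ m + 1) (lam m) < 1 / 8 := by
      have he := eCol_le_exp hpI₂ (by linarith) hlam
      have hK0 : (0 : ℝ) ≤ K₁ m := Nat.cast_nonneg _
      have : (K₁ m : ℝ) = 401 * (m : ℝ) ^ 1 := by unfold K₁; push_cast; ring
      calc (K₁ m : ℝ) * eCol (p₂ m) (2 * K₁ m + 1) (lam m)
          ≤ (K₁ m : ℝ) * exp (-(3 * lam m / 8)) := mul_le_mul_of_nonneg_left he hK0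
        _ = 401 * (m : ℝ) ^ 1 * exp (-(3 * lam m / 8)) := by rw [this]
        _ < 1 / 8 := hE1
    have h3 := mul_le_mul_of_nonneg_left hfac₂ hTm0
    linarith
  have hsmall₃ : p₃ m ^ 2 * (2 * (K₂ : ℝ) * K₂) / 1 +
      K₂ * eCol (p₃ m) (2 * K₂ + 1) (lam m) +
      (T.card : ℝ) * m * (eRow (p₃ m) (2 * K₂ + 1) ((m : ℝ) / 16) +
        eCol (p₃ m) (2 * K₂ + 1) ((m : ℝ) / 16) +
        eRow (p₃ m) (2 * K₂ + 1) ((B₁ m : ℝ) / 8) +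
        eCol (p₃ m) (2 * K₂ + 1) ((B₁ m : ℝ) / 8)) < 1 := by
    have h2 : (K₂ : ℝ) * eCol (p₃ m) (2 * K₂ + 1) (lam m) < 1 / 8 := by
      have he := eCol_le_exp hpI₃ (by linarith) hlam
      have hK0 : (0 : ℝ) ≤ K₂ := Nat.cast_nonneg _
      calc (K₂ : ℝ) * eCol (p₃ m) (2 * K₂ + 1) (lam m)
          ≤ (K₂ : ℝ) * exp (-(3 * lam m / 8)) := mul_le_mul_of_nonneg_left he hK0
        _ = K₂ * (m : ℝ) ^ 0 * exp (-(3 * lam m / 8)) := by rw [pow_zero, mul_one]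
        _ < 1 / 8 := hE1'
    have h3 := mul_le_mul_of_nonneg_left hfac₃ hTm0
    linarith
  obtain ⟨r₃, hadm₃, hr₃, -, hfree, -⟩ :=
    two_repicks T s₀ r₁ key hm0 (fun c => (heavyRows T c (NC m))ᶜ) hadm hr₁ hn₁ hroom' hK₁ hK₂
      hp₂ hp₂m hp₂n hlam hlam ht₂ ht₂ hδ hδ hn₂ hp₃ hp₃m hp₃n hsmall₂ hsmall₃
  refine ⟨s₀, r₃, ?_, fun c => Finset.mem_compl.mp (hadm₃ c), hfree⟩
  refine not_mem_phaseABad_mono T (MC m) (NC m) (m / 2) (pC m) ?_ ?_ hr₃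
  · unfold tA; linarith
  · have hBA : ((BA m : ℕ) : ℝ) ≤ (B₁ m : ℝ) / 2 := by unfold BA; exact Nat.cast_div_le
    linarith [I₂_pos, I₃_pos]

/-! ## 5. The schedule arithmetic -/

/-- **(NUM) FOR SCHEDULE A**: budget, threshold room and bad-line bound, eventually.
[this file] -/
theorem scheduleA_ok : ∃ m₀ : ℕ, ∀ m : ℕ, m₀ ≤ m →
    2 * ((LC m : ℝ) + (pC m * ((m : ℝ) * MC m) + tA m)) ≤ m ∧
      m / 2 + BA m ≤ m + 1 ∧ 2 * (2 * qOf m + 1) ≤ MC m * LC m * BA m := by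
  obtain ⟨m₀, hm₀⟩ := Filter.eventually_atTop.mp ((eventually_ge_atTop 128).and
    linear_eventually)
  refine ⟨m₀, fun m hm => ?_⟩
  obtain ⟨h128, -, -, -, hI8, -, hBC⟩ := hm₀ m hm
  refine ⟨?_, ?_, ?_⟩
  · have hL : (LC m : ℝ) ≤ m / 8 := by unfold LC; exact Nat.cast_div_le
    have hp := pmM_le (m := m) (by omega)
    unfold tA tC
    linarith
  · have h := hn₀_B₁ m
    have : BA m ≤ B₁ m := Nat.div_le_self _ _
    unfold BA at this ⊢; omega
  · have h := hMLB_holds (m := m) h128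
    have hB : BC ≤ BA m := by
      unfold BA; exact (Nat.le_div_iff_mul_le (by norm_num)).2 (by omega)
    exact h.trans (Nat.mul_le_mul_left _ hB)

end Summit.ValiantsHypothesis.ValiantsHypothesis.Theorems.DefinabilityGapAlteration
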